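import Summits.ValiantsHypothesis.ValiantsHypothesis.Theorems.SymPencilPerFourInnerRankFamily

/-!
# Route `SymPencil` — inner rank of the `2 | 2` row split of `per_4`, III: all column pairs and
# the column types (`--supports` stmt-ValiantsHypothesis-5674 `SdcSuperquadratic`; toward the cell
# hypothesis `H88` / Task T2 of `Cruxes/SdcSuperquadratic/NEXT-RUNG-25.md`; rung currency only)

Setting as in `SymPencilPerFourInnerRankRows`: a joint `8`-square family
`Σ_r c_r t_r((a,b),(y₂,y₃))² = per (a; b; y₂; y₃)` (`hJ`), `t_r` bilinear.

* SYMMETRY (`hJ_perm`, `hJ_swap`, `hJ_yswap`): the hypothesis is invariant under a simultaneous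
  permutation `π` of the four columns (`per` of a column-permuted matrix), under `a ↔ b` and under
  `y₂ ↔ y₃`.  Hence `SymPencilPerFourInnerRankFamily.family₂₃` holds for EVERY column pair
  `c ≠ d` (`family_pair`: the `a`-parts of the columns `c, d` of the `y₂`-block of `t` vanish,
  with `n_{cc} = n_{dd} = 0`, `n_{dc} = n_{cd}` for `n_{jk} = t((0,e_j),(e_k,0))` — or the same in
  the `y₃`-block) and for the row-swapped families (`family_pair'`: the same for the `b`-parts).
* COLUMN TYPES (`allX_or_allY`): write `t_r((a,b),y) = t_r((a,0),y) + t_r((0,b),y)`.  A column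
  whose `a`-part and `b`-part both vanish is a zero column — impossible by
  `eq_zero_of_forall_left/right`.  So each pair `{c,d}` is of type `X` (`a`-parts of the
  `y₂`-block and `b`-parts of the `y₃`-block vanish on the columns `c, d`) or of type `Y` (mirror
  image), two pairs through a common column have the same type, and therefore ALL columns have
  type `X` or all have type `Y`: the family is PURE — its `y₂`-block depends only on `b` and its
  `y₃`-block only on `a`, or conversely.

The companion `SymPencilPerFourInnerRankNine` kills the pure case.  Honest framing: lemmas;
`sdc(per_4) ≥ 25` unchanged; the crux `SdcSuperquadratic` and `VP ≠ VNP` untouched.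
No definitions, no named facts. [folklore]
-/

noncomputable section

-- single-conjunct layout: Sub = Summit, duplicated namespace component intended
set_option linter.dupNamespace false

namespace Summit.ValiantsHypothesis.ValiantsHypothesis.Theorems.SymPencilPerFourInnerRankPairs

open Matrix Finset Module
open Summit.ValiantsHypothesis.ValiantsHypothesis.Theorems.SymPencilPerFourBlocks
open Summit.ValiantsHypothesis.ValiantsHypothesis.Theorems.SymPencilPerFourInnerRankRows
open Summit.ValiantsHypothesis.ValiantsHypothesis.Theorems.SymPencilPerFourInnerRankFamily

/-! ### Symmetries of the hypothesis -/

/-- Permuting the columns of all four rows is a column permutation of the matrix. [folklore] -/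
theorem of_rows_comp_perm {R : Type*} (π : Equiv.Perm (Fin 4)) (a b v w : Fin 4 → R) :
    Matrix.of ![a ∘ π, b ∘ π, v ∘ π, w ∘ π] = (Matrix.of ![a, b, v, w]).submatrix id π := by
  ext i j
  fin_cases i <;> simp

variable {K : Type*} [Field K]

/-- `e_i ∘ π = e_{π⁻¹ i}`. [folklore] -/
theorem single_comp_perm (π : Equiv.Perm (Fin 4)) (i : Fin 4) :
    ((Pi.single i (1 : K) : Fin 4 → K) ∘ π) = Pi.single (π.symm i) 1 := by
  funext j
  simp [Pi.single_apply, Equiv.apply_eq_iff_eq_symm_apply]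

/-- A permutation of `Fin 4` with prescribed values at `2` and `3`. [folklore] -/
theorem exists_perm_two_three (c d : Fin 4) (hcd : c ≠ d) :
    ∃ σ : Equiv.Perm (Fin 4), σ 2 = c ∧ σ 3 = d := by
  obtain ⟨σ₀, h0, h1⟩ := exists_perm_zero_one c d hcd
  refine ⟨σ₀ * (Equiv.swap 0 2 * Equiv.swap 1 3), ?_, ?_⟩
  · rw [Equiv.Perm.mul_apply, Equiv.Perm.mul_apply, show Equiv.swap (1 : Fin 4) 3 2 = 2 by decide,
      show Equiv.swap (0 : Fin 4) 2 2 = 0 by decide, h0]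
  · rw [Equiv.Perm.mul_apply, Equiv.Perm.mul_apply, show Equiv.swap (1 : Fin 4) 3 3 = 1 by decide,
      show Equiv.swap (0 : Fin 4) 2 1 = 1 by decide, h1]

/-- **Column symmetry**: transporting a joint `8`-square family along a simultaneous column
permutation `π` gives a joint `8`-square family. [folklore] -/
theorem hJ_perm (c : Fin 8 → K)
    (t : Fin 8 → (((Fin 4 → K) × (Fin 4 → K)) →ₗ[K] ((Fin 4 → K) × (Fin 4 → K)) →ₗ[K] K))
    (hJ : ∀ a b y₂ y₃ : Fin 4 → K,
      ∑ r, c r * (t r (a, b) (y₂, y₃)) ^ 2 = (Matrix.of ![a, b, y₂, y₃]).permanent)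
    (π : Equiv.Perm (Fin 4)) :
    ∀ a b y₂ y₃ : Fin 4 → K,
      ∑ r, c r * ((t r).compl₁₂
        ((LinearEquiv.funCongrLeft K K π).prodCongr (LinearEquiv.funCongrLeft K K π)).toLinearMap
        ((LinearEquiv.funCongrLeft K K π).prodCongr (LinearEquiv.funCongrLeft K K π)).toLinearMap
          (a, b) (y₂, y₃)) ^ 2 = (Matrix.of ![a, b, y₂, y₃]).permanent := by
  intro a b y₂ y₃
  have h := hJ (a ∘ π) (b ∘ π) (y₂ ∘ π) (y₃ ∘ π)
  rw [of_rows_comp_perm, Matrix.permanent_permute_rows] at h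
  exact h

/-- **Row symmetry `a ↔ b`.** [folklore] -/
theorem hJ_swap (c : Fin 8 → K)
    (t : Fin 8 → (((Fin 4 → K) × (Fin 4 → K)) →ₗ[K] ((Fin 4 → K) × (Fin 4 → K)) →ₗ[K] K))
    (hJ : ∀ a b y₂ y₃ : Fin 4 → K,
      ∑ r, c r * (t r (a, b) (y₂, y₃)) ^ 2 = (Matrix.of ![a, b, y₂, y₃]).permanent) :
    ∀ a b y₂ y₃ : Fin 4 → K,
      ∑ r, c r * ((t r).compl₁₂ (LinearEquiv.prodComm K (Fin 4 → K) (Fin 4 → K)).toLinearMap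
        LinearMap.id (a, b) (y₂, y₃)) ^ 2 = (Matrix.of ![a, b, y₂, y₃]).permanent := by
  intro a b y₂ y₃
  have h := hJ b a y₂ y₃
  rw [per_swap_row₀₁] at h
  exact h

/-- **Row symmetry `y₂ ↔ y₃`.** [folklore] -/
theorem hJ_yswap (c : Fin 8 → K)
    (t : Fin 8 → (((Fin 4 → K) × (Fin 4 → K)) →ₗ[K] ((Fin 4 → K) × (Fin 4 → K)) →ₗ[K] K))
    (hJ : ∀ a b y₂ y₃ : Fin 4 → K,
      ∑ r, c r * (t r (a, b) (y₂, y₃)) ^ 2 = (Matrix.of ![a, b, y₂, y₃]).permanent) :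
    ∀ a b y₂ y₃ : Fin 4 → K,
      ∑ r, c r * ((t r).compl₂ (LinearEquiv.prodComm K (Fin 4 → K) (Fin 4 → K)).toLinearMap
        (a, b) (y₂, y₃)) ^ 2 = (Matrix.of ![a, b, y₂, y₃]).permanent := by
  intro a b y₂ y₃
  have h := hJ a b y₃ y₂
  rw [per_swap_row₂₃] at h
  exact h

/-! ### The family alternative for every column pair and both row orders -/

/-- **Every column pair `c ≠ d`, base family `b ∈ span(e_c, e_d)`**: either the `a`-parts of the
columns `c, d` of the `y₂`-block vanish (with `n_{cc} = n_{dd} = 0`, `n_{dc} = n_{cd}` for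
`n_{jk} = t((0,e_j),(e_k,0))`), or the same for the `y₃`-block. [folklore] -/
theorem family_pair [CharZero K] (c : Fin 8 → K)
    (t : Fin 8 → (((Fin 4 → K) × (Fin 4 → K)) →ₗ[K] ((Fin 4 → K) × (Fin 4 → K)) →ₗ[K] K))
    (hJ : ∀ a b y₂ y₃ : Fin 4 → K,
      ∑ r, c r * (t r (a, b) (y₂, y₃)) ^ 2 = (Matrix.of ![a, b, y₂, y₃]).permanent)
    (i j : Fin 4) (hij : i ≠ j) :
    ((∀ (a : Fin 4 → K) r, t r (a, 0) (Pi.single i 1, 0) = 0) ∧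
      (∀ (a : Fin 4 → K) r, t r (a, 0) (Pi.single j 1, 0) = 0) ∧
      (∀ r, t r (0, Pi.single i 1) (Pi.single i 1, 0) = 0) ∧
      (∀ r, t r (0, Pi.single j 1) (Pi.single j 1, 0) = 0) ∧
      (∀ r, t r (0, Pi.single j 1) (Pi.single i 1, 0) = t r (0, Pi.single i 1) (Pi.single j 1, 0))) ∨
    ((∀ (a : Fin 4 → K) r, t r (a, 0) (0, Pi.single i 1) = 0) ∧
      (∀ (a : Fin 4 → K) r, t r (a, 0) (0, Pi.single j 1) = 0) ∧
      (∀ r, t r (0, Pi.single i 1) (0, Pi.single i 1) = 0) ∧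
      (∀ r, t r (0, Pi.single j 1) (0, Pi.single j 1) = 0) ∧
      (∀ r, t r (0, Pi.single j 1) (0, Pi.single i 1) = t r (0, Pi.single i 1) (0, Pi.single j 1))) := by
  obtain ⟨σ, h2, h3⟩ := exists_perm_two_three i j hij
  set π := σ.symm with hπ
  have hπ2 : π.symm 2 = i := by rw [hπ, Equiv.symm_symm, h2]
  have hπ3 : π.symm 3 = j := by rw [hπ, Equiv.symm_symm, h3]
  set P := ((LinearEquiv.funCongrLeft K K π).prodCongr (LinearEquiv.funCongrLeft K K π)).toLinearMap
    with hP
  set t' : Fin 8 → (((Fin 4 → K) × (Fin 4 → K)) →ₗ[K] ((Fin 4 → K) × (Fin 4 → K)) →ₗ[K] K) :=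
    fun r => (t r).compl₁₂ P P with ht'
  have hev : ∀ r (a b v w : Fin 4 → K), t' r (a, b) (v, w) = t r (a ∘ π, b ∘ π) (v ∘ π, w ∘ π) :=
    fun r a b v w => rfl
  have hJ' : ∀ a b y₂ y₃ : Fin 4 → K,
      ∑ r, c r * (t' r (a, b) (y₂, y₃)) ^ 2 = (Matrix.of ![a, b, y₂, y₃]).permanent :=
    hJ_perm c t hJ π
  have e2 : ((Pi.single 2 (1 : K) : Fin 4 → K) ∘ π) = Pi.single i 1 := by
    rw [single_comp_perm, hπ2]
  have e3 : ((Pi.single 3 (1 : K) : Fin 4 → K) ∘ π) = Pi.single j 1 := by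
    rw [single_comp_perm, hπ3]
  have z0 : ((0 : Fin 4 → K) ∘ π) = 0 := rfl
  -- any `a'` is of the form `a ∘ π`
  have hsurj : ∀ a' : Fin 4 → K, (a' ∘ π.symm) ∘ π = a' := fun a' => by
    funext q; simp
  rcases family₂₃ c t' hJ' with hA | hB
  · left
    obtain ⟨h1, h2', h3', h4, h5⟩ := columns_of_caseA t' hA
    simp only [hev, e2, e3, z0] at h1 h2' h3' h4 h5
    exact ⟨fun a r => by simpa [hsurj] using h1 (a ∘ π.symm) r,
      fun a r => by simpa [hsurj] using h2' (a ∘ π.symm) r, h3', h4, h5⟩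
  · right
    obtain ⟨h1, h2', h3', h4, h5⟩ := columns_of_caseB t' hB
    simp only [hev, e2, e3, z0] at h1 h2' h3' h4 h5
    exact ⟨fun a r => by simpa [hsurj] using h1 (a ∘ π.symm) r,
      fun a r => by simpa [hsurj] using h2' (a ∘ π.symm) r, h3', h4, h5⟩

/-- **Every column pair, base family `a ∈ span(e_c, e_d)`** (the row-swapped `family_pair`):
either the `b`-parts of the columns `c, d` of the `y₂`-block vanish, or those of the
`y₃`-block. [folklore] -/
theorem family_pair' [CharZero K] (c : Fin 8 → K)
    (t : Fin 8 → (((Fin 4 → K) × (Fin 4 → K)) →ₗ[K] ((Fin 4 → K) × (Fin 4 → K)) →ₗ[K] K))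
    (hJ : ∀ a b y₂ y₃ : Fin 4 → K,
      ∑ r, c r * (t r (a, b) (y₂, y₃)) ^ 2 = (Matrix.of ![a, b, y₂, y₃]).permanent)
    (i j : Fin 4) (hij : i ≠ j) :
    ((∀ (b : Fin 4 → K) r, t r (0, b) (Pi.single i 1, 0) = 0) ∧
      (∀ (b : Fin 4 → K) r, t r (0, b) (Pi.single j 1, 0) = 0)) ∨
    ((∀ (b : Fin 4 → K) r, t r (0, b) (0, Pi.single i 1) = 0) ∧
      (∀ (b : Fin 4 → K) r, t r (0, b) (0, Pi.single j 1) = 0)) := by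
  set t' : Fin 8 → (((Fin 4 → K) × (Fin 4 → K)) →ₗ[K] ((Fin 4 → K) × (Fin 4 → K)) →ₗ[K] K) :=
    fun r => (t r).compl₁₂ (LinearEquiv.prodComm K (Fin 4 → K) (Fin 4 → K)).toLinearMap
      LinearMap.id with ht'
  have hev : ∀ r (a b : Fin 4 → K) (y : (Fin 4 → K) × (Fin 4 → K)), t' r (a, b) y = t r (b, a) y :=
    fun r a b y => rfl
  rcases family_pair c t' (hJ_swap c t hJ) i j hij with ⟨h1, h2, -⟩ | ⟨h1, h2, -⟩
  · left
    simp only [hev] at h1 h2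
    exact ⟨h1, h2⟩
  · right
    simp only [hev] at h1 h2
    exact ⟨h1, h2⟩

/-! ### Column types -/

/-- **All columns have type `X`, or all have type `Y`.**  Type `X` of a column `k`: the
`a`-part of column `k` of the `y₂`-block and the `b`-part of column `k` of the `y₃`-block vanish;
type `Y`: the mirror statement. [folklore] -/
theorem allX_or_allY [CharZero K] (c : Fin 8 → K)
    (t : Fin 8 → (((Fin 4 → K) × (Fin 4 → K)) →ₗ[K] ((Fin 4 → K) × (Fin 4 → K)) →ₗ[K] K))
    (hJ : ∀ a b y₂ y₃ : Fin 4 → K,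
      ∑ r, c r * (t r (a, b) (y₂, y₃)) ^ 2 = (Matrix.of ![a, b, y₂, y₃]).permanent) :
    (∀ k : Fin 4, (∀ (a : Fin 4 → K) r, t r (a, 0) (Pi.single k 1, 0) = 0) ∧
        (∀ (b : Fin 4 → K) r, t r (0, b) (0, Pi.single k 1) = 0)) ∨
    (∀ k : Fin 4, (∀ (a : Fin 4 → K) r, t r (a, 0) (0, Pi.single k 1) = 0) ∧
        (∀ (b : Fin 4 → K) r, t r (0, b) (Pi.single k 1, 0) = 0)) := by
  have hsplit : ∀ (a b : Fin 4 → K) (y : (Fin 4 → K) × (Fin 4 → K)) r,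
      t r (a, b) y = t r (a, 0) y + t r (0, b) y := fun a b y r => by
    rw [← LinearMap.add_apply, ← map_add]; simp
  -- a column cannot have both parts zero
  have excl₂ : ∀ k : Fin 4, (∀ (a : Fin 4 → K) r, t r (a, 0) (Pi.single k 1, 0) = 0) →
      (∀ (b : Fin 4 → K) r, t r (0, b) (Pi.single k 1, 0) = 0) → False := fun k ha hb => by
    have h := eq_zero_of_forall_left c t hJ (Pi.single k 1) fun a b r => by
      rw [hsplit, ha, hb, add_zero]
    simpa using congr_fun h k
  have excl₃ : ∀ k : Fin 4, (∀ (a : Fin 4 → K) r, t r (a, 0) (0, Pi.single k 1) = 0) →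
      (∀ (b : Fin 4 → K) r, t r (0, b) (0, Pi.single k 1) = 0) → False := fun k ha hb => by
    have h := eq_zero_of_forall_right c t hJ (Pi.single k 1) fun a b r => by
      rw [hsplit, ha, hb, add_zero]
    simpa using congr_fun h k
  -- the type of a pair
  have pair : ∀ i j : Fin 4, i ≠ j →
      (((∀ (a : Fin 4 → K) r, t r (a, 0) (Pi.single i 1, 0) = 0) ∧
        (∀ (b : Fin 4 → K) r, t r (0, b) (0, Pi.single i 1) = 0)) ∧
       ((∀ (a : Fin 4 → K) r, t r (a, 0) (Pi.single j 1, 0) = 0) ∧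
        (∀ (b : Fin 4 → K) r, t r (0, b) (0, Pi.single j 1) = 0))) ∨
      (((∀ (a : Fin 4 → K) r, t r (a, 0) (0, Pi.single i 1) = 0) ∧
        (∀ (b : Fin 4 → K) r, t r (0, b) (Pi.single i 1, 0) = 0)) ∧
       ((∀ (a : Fin 4 → K) r, t r (a, 0) (0, Pi.single j 1) = 0) ∧
        (∀ (b : Fin 4 → K) r, t r (0, b) (Pi.single j 1, 0) = 0))) := by
    intro i j hij
    rcases family_pair c t hJ i j hij with ⟨hAi, hAj, -⟩ | ⟨hBi, hBj, -⟩ <;>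
      rcases family_pair' c t hJ i j hij with ⟨hA'i, hA'j⟩ | ⟨hB'i, hB'j⟩
    · exact (excl₂ i hAi hA'i).elim
    · exact Or.inl ⟨⟨hAi, hB'i⟩, ⟨hAj, hB'j⟩⟩
    · exact Or.inr ⟨⟨hBi, hA'i⟩, ⟨hBj, hA'j⟩⟩
    · exact (excl₃ i hBi hB'i).elim
  have hcases : ∀ k : Fin 4, k = 0 ∨ k = 1 ∨ k = 2 ∨ k = 3 := by decide
  rcases pair 0 1 (by decide) with ⟨hX0, hX1⟩ | ⟨hY0, hY1⟩
  · left
    have hX2 := (pair 0 2 (by decide)).resolve_right fun h => excl₂ 0 hX0.1 h.1.2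
    have hX3 := (pair 0 3 (by decide)).resolve_right fun h => excl₂ 0 hX0.1 h.1.2
    intro k
    rcases hcases k with rfl | rfl | rfl | rfl
    exacts [hX0, hX1, hX2.2, hX3.2]
  · right
    have hY2 := (pair 0 2 (by decide)).resolve_left fun h => excl₂ 0 h.1.1 hY0.2
    have hY3 := (pair 0 3 (by decide)).resolve_left fun h => excl₂ 0 h.1.1 hY0.2
    intro k
    rcases hcases k with rfl | rfl | rfl | rfl
    exacts [hY0, hY1, hY2.2, hY3.2]


end Summit.ValiantsHypothesis.ValiantsHypothesis.Theorems.SymPencilPerFourInnerRankPairs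

end
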